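import Mathlib
import HarnessLib
import Summits.QuantumFields.QCD.Theses.PauliWegnerSea

/-!
# Sketch — crux-ideate stmt-QuantumFields-9151 (PhaseQuenchedFlavourDecay), ideator 1, round 1

First lemmas of the idea cards `sea-pays-every-pole` and `feshbach-fibre-tameness`.
Nothing here is proved; every declaration is a `Prop` that must elaborate.
-/

open scoped BigOperators ENNReal
open MeasureTheory Filter

namespace Summit.QuantumFields.QCD.Cruxes.PhaseQuenchedFlavourDecay.Sketch

/-! ## Card `sea-pays-every-pole` -/

/-- FIRST LEMMA (abstract, provable now): the Chebyshev height-split interpolation.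
If `∫ f^s ≤ ε` (`0 < s < 1`) and the first-moment tail obeys `∫_{f > K} f ≤ C K^{-γ}` for every
`K > 0`, then `∫ f ≤ (1 + C) ε^{γ/(1-s+γ)}` (take `K = ε^{-1/(1-s+γ)}`). -/
def ChebyshevInterpolation : Prop :=
  ∀ (α : Type) [MeasurableSpace α] (μ : Measure α) (f : α → ℝ≥0∞), Measurable f →
    ∀ (s γ ε C : ℝ), 0 < s → s < 1 → 0 < γ → 0 < ε → 0 ≤ C →
      (∫⁻ x, f x ^ s ∂μ) ≤ ENNReal.ofReal ε →
      (∀ K : ℝ, 0 < K →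
        (∫⁻ x in {x | ENNReal.ofReal K < f x}, f x ∂μ) ≤ ENNReal.ofReal (C * K ^ (-γ))) →
      (∫⁻ x, f x ∂μ) ≤ ENNReal.ofReal ((1 + C) * ε ^ (γ / (1 - s + γ)))

open Literature.MathematicalPhysics.QuantumFieldTheory Literature.MathematicalPhysics.QuantumLattice
  Literature.Probability.LatticeModels

/-- The phase-quenched (`|det diracMatrix|`-reweighted) Wilson expectation on the torus of side
`2S+1` — verbatim the normalised ratio appearing in clause (ii) and in the crux. -/
noncomputable def pqExpect {Nf : ℕ} (β : ℝ) (S : ℕ) (mq : Fin Nf → ℝ)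
    (F : GaugeConfig 4 (2 * S + 1) (Matrix.specialUnitaryGroup (Fin 3) ℂ) → ℝ) : ℝ :=
  (∫ U : GaugeConfig 4 (2 * S + 1) (Matrix.specialUnitaryGroup (Fin 3) ℂ),
      ‖(diracMatrix U mq).det‖ * F U ∂(wilsonMeasure (fundamentalRep (Fin 3)) β)) /
    (∫ U : GaugeConfig 4 (2 * S + 1) (Matrix.specialUnitaryGroup (Fin 3) ℂ),
      ‖(diracMatrix U mq).det‖ ∂(wilsonMeasure (fundamentalRep (Fin 3)) β))

/-- `MinorTail` (the n-INDEPENDENT a-priori input TAIL_γ): the `r×r` minors of the inverse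
`N_f`-flavour Wilson–Dirac matrix (all Wick terms of all quark boxes are such minors, flavour by
flavour) have a uniform POWER tail under the phase-quenched measure:
`E_{|w|}[ |g| · 1{|g| > K} ] ≤ C_r K^{-γ}` for all `K > 0`, eventually in `k`, uniformly in the
volume `S ≥ L_k` and in the positions. -/
def MinorTail (Nf : ℕ) (reg : QCDRegularisation Nf) (m : Fin Nf → ℝ) (r : ℕ) : Prop :=
  ∃ C γ : ℝ, 0 < γ ∧ ∀ᶠ k in atTop, ∀ S : ℕ, reg.L k ≤ S →
    ∀ (I J : Fin r → QuarkVar Nf (2 * S + 1)) (K : ℝ), 0 < K →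
      pqExpect (reg.β k) S (fun fl => reg.mcrit k + reg.a k * m fl / reg.Zm k)
        (fun U =>
          let g : ℝ := ‖((diracMatrix U fun fl => reg.mcrit k + reg.a k * m fl / reg.Zm k)⁻¹.submatrix
              (fun t => quarkEquiv (I t)) (fun t => quarkEquiv (J t))).det‖
          if K < g then g else 0) ≤ C * K ^ (-γ)

/-- `SeaRepulsion` (LDOS_γ, the spectral form of the input, `r = 1`): the phase-quenched LOCAL
density of states of the Hermitian Wilson–Dirac operator `H_f = γ₅ D_W(m_f(k))` of every flavour
vanishes at zero faster than the quenched Wegner rate by a power: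
`E_{|w|}[ tr_{colour,spin} (H_f² + τ²)⁻¹(x,x) ] ≤ C τ^{γ-1}` for `0 < τ ≤ τ₀`
(equivalently `μ̄_x(−τ,τ) ≲ τ^{1+γ}` for the sea-averaged spectral measure at `x`). -/
def SeaRepulsion (Nf : ℕ) (reg : QCDRegularisation Nf) (m : Fin Nf → ℝ) : Prop :=
  ∃ C γ τ₀ : ℝ, 0 < γ ∧ 0 < τ₀ ∧ ∀ᶠ k in atTop, ∀ S : ℕ, reg.L k ≤ S →
    ∀ (f : Fin Nf) (x : TorusSite 4 (2 * S + 1)) (τ : ℝ), 0 < τ → τ ≤ τ₀ →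
      pqExpect (reg.β k) S (fun fl => reg.mcrit k + reg.a k * m fl / reg.Zm k)
        (fun U =>
          let H : Matrix (TorusSite 4 (2 * S + 1) × Fin 3 × Fin 4)
              (TorusSite 4 (2 * S + 1) × Fin 3 × Fin 4) ℂ :=
            spinorLift gammaFive *
              wilsonDirac (fundamentalRep (Fin 3)) U (reg.mcrit k + reg.a k * m f / reg.Zm k) 1
          ∑ a : Fin 3, ∑ i : Fin 4, ((H * H + ((τ ^ 2 : ℝ) : ℂ) • 1)⁻¹ (x, a, i) (x, a, i)).re)
        ≤ C * τ ^ (γ - 1)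

/-- `SeaRepulsionMinami` (LDOS_{r,γ}, the `r`-mode form needed for baryons / multi-line channels):
the sea-averaged `r`-point Minami determinant of `(H_f² + τ²)⁻¹` at `r` quark indices is
`≤ C_r τ^{r(γ-1)}`. -/
def SeaRepulsionMinami (Nf : ℕ) (reg : QCDRegularisation Nf) (m : Fin Nf → ℝ) (r : ℕ) : Prop :=
  ∃ C γ τ₀ : ℝ, 0 < γ ∧ 0 < τ₀ ∧ ∀ᶠ k in atTop, ∀ S : ℕ, reg.L k ≤ S →
    ∀ (f : Fin Nf) (ι : Fin r → TorusSite 4 (2 * S + 1) × Fin 3 × Fin 4), Function.Injective ι →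
      ∀ τ : ℝ, 0 < τ → τ ≤ τ₀ →
      pqExpect (reg.β k) S (fun fl => reg.mcrit k + reg.a k * m fl / reg.Zm k)
        (fun U =>
          let H : Matrix (TorusSite 4 (2 * S + 1) × Fin 3 × Fin 4)
              (TorusSite 4 (2 * S + 1) × Fin 3 × Fin 4) ℂ :=
            spinorLift gammaFive *
              wilsonDirac (fundamentalRep (Fin 3)) U (reg.mcrit k + reg.a k * m f / reg.Zm k) 1
          (((H * H + ((τ ^ 2 : ℝ) : ℂ) • 1)⁻¹.submatrix ι ι).det).re)
        ≤ C * τ ^ (r * (γ - 1))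

/-- TRANSFER `C⁺ → C` for card `sea-pays-every-pole`: the a-priori tail for every regularisation
and every minor order implies the crux (the remaining implication is the kinematic
Chebyshev/Wick/charge-counting argument fed by clause (ii)). -/
def TailTransfer : Prop :=
  (∀ (Nf : ℕ) (reg : QCDRegularisation Nf) (m : Fin Nf → ℝ) (r : ℕ),
      (∀ f, 0 < m f) → MinorTail Nf reg m r) →
    Summit.QuantumFields.QCD.Theses.PauliWegnerSea.PhaseQuenchedFlavourDecay

/-- The spectral route to the tail: sea repulsion (all `r`) gives the minor tail. -/
def RepulsionGivesTail : Prop :=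
  ∀ (Nf : ℕ) (reg : QCDRegularisation Nf) (m : Fin Nf → ℝ),
    (∀ r, SeaRepulsionMinami Nf reg m r) → ∀ r, MinorTail Nf reg m r

/-! ## Card `feshbach-fibre-tameness` -/

/-- FIRST LEMMA (linear algebra, provable now from `Matrix.invOf_fromBlocks₂₂_eq`): every minor of
the inverse supported on the block `T` is the same minor of the inverse FESHBACH (Schur-complement)
matrix `S_T = A - B D⁻¹ C` of size `|T|`, whatever the size of the complement. -/
def FeshbachMinor : Prop :=
  ∀ (p q r : ℕ) (A : Matrix (Fin p) (Fin p) ℂ) (B : Matrix (Fin p) (Fin q) ℂ)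
    (C : Matrix (Fin q) (Fin p) ℂ) (D : Matrix (Fin q) (Fin q) ℂ) (I J : Fin r → Fin p),
    IsUnit D.det → IsUnit (Matrix.fromBlocks A B C D).det →
      ((Matrix.fromBlocks A B C D)⁻¹.submatrix (Sum.inl ∘ I) (Sum.inl ∘ J)).det =
        ((A - B * D⁻¹ * C)⁻¹.submatrix I J).det

/-- Jacobi's complementary-minor identity on the SMALL matrix (provable now; the only place a
determinant is ever divided): for invertible `S` of size `p` and an `r`-minor,
`det S · det (S⁻¹[I,J]) = ± det S[Jᶜ, Iᶜ]`, stated through `Matrix.adjugate` for `r = 1`. -/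
def FeshbachAdjugate : Prop :=
  ∀ (p : ℕ) (S : Matrix (Fin p) (Fin p) ℂ) (i j : Fin p), IsUnit S.det →
    S.det * S⁻¹ i j = S.adjugate i j

/-- The fibre degree bound that makes the Feshbach family TAME: along any one-parameter diagonal
twist of ONE boundary link the Feshbach determinant `det S_T = det D / det D_{TᶜTᶜ}` is a
trigonometric polynomial of degree ≤ 4 (it inherits `PauliBandLimit`, since `det D_{TᶜTᶜ}` does
not see the link) — stated for the full `N_f`-flavour matrix and a block `T` = the quark indices
at a finite set of sites. -/
def FeshbachBandLimit : Prop :=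
  ∀ (L : ℕ) [NeZero L] (U : GaugeConfig 4 L (Matrix.specialUnitaryGroup (Fin 3) ℂ)) (m₀ : ℝ)
    (e : Edge 4 L) (T : Finset (TorusSite 4 L)) (Tw : ℝ → Matrix.specialUnitaryGroup (Fin 3) ℂ),
    (∀ θ : ℝ, ((Tw θ : Matrix.specialUnitaryGroup (Fin 3) ℂ) : Matrix (Fin 3) (Fin 3) ℂ) =
        Matrix.diagonal ![Complex.exp (θ * Complex.I), Complex.exp (-(θ * Complex.I)), 1]) →
    e.1 ∈ T → Site.shift e.1 e.2 ∉ T →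
      let D : ℝ → Matrix (TorusSite 4 L × Fin 3 × Fin 4) (TorusSite 4 L × Fin 3 × Fin 4) ℂ :=
        fun θ => wilsonDirac (fundamentalRep (Fin 3)) (Function.update U e (U e * Tw θ)) m₀ 1
      let out : (TorusSite 4 L × Fin 3 × Fin 4) → Prop := fun v => v.1 ∉ T
      (∀ θ, ((D θ).submatrix (fun v : {v // out v} => v.1) (fun v : {v // out v} => v.1)).det =
          ((D 0).submatrix (fun v : {v // out v} => v.1) (fun v : {v // out v} => v.1)).det) ∧
      ∃ c : Fin 9 → ℂ, ∀ θ : ℝ,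
        ((D 0).submatrix (fun v : {v // out v} => v.1) (fun v : {v // out v} => v.1)).det *
            (∑ k : Fin 9, c k * Complex.exp ((((k : ℕ) : ℝ) - 4 : ℝ) * θ * Complex.I)) =
          (D θ).det

end Summit.QuantumFields.QCD.Cruxes.PhaseQuenchedFlavourDecay.Sketch
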